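/-
Origin: expansion seat `prover-pub-hodgecm-mc-sinst-1-g11-0`, handover #1270 2026-08-21T03:47Z md5 503fb57f1c6e (372 l.; NEW additive leaf, ns HodgeCM.Model.ThetaAdelicSide; SLOT 3 = the slot-1 text of #1264 on the conjugated plane's second line ⟨a₃⟩, a₃ = dW' c.D 1: § 0 NEW `def splitLineThreeG V c hGR₃` (JW := diagonal (lineVec (dW' c.D 1)), s := splittingOf hGR₃) and `def chiThreeG c χ : UfThree c.D →* ℂˣ`; § 1 `cVThreeG ∕ cWThreeG ∕ psiThreeG η₃` (finCharThree of #1257), chiThreeG_eq_mul_psiThreeG, ωfW_∕ωfV_threeG_finSBReindex, `def coinvEquivThreeG` (+_mk), coinvRep_coinvEquivThreeG, coinvEquivThreeG_twist_of_eq, `def ΩEquivThreeG`, iSup_range_coinvRep_threeG_eq, `def dictEquivThreeOfBigChar`; § 2 `def adelicCharThree η₃ := η₃(·,1)·χ₃′(·,1)` (χ₃′ = cmConjLineChar₁ = λ₄′ ∘ snd) (+_apply), lineVec_dW'_one_ne, `def bigCharThree`, twistCharV_bigCharThree_comp, cmConjLineChar₁_inl_eq_one (identically 1), adelicCharThree_eq_one_of_rat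 (hη₃V : ∀ v ∈ CMRat (frameD V), η₃ (v,1) = 1), bigCharThree_isRatTrivial, `def splitLineThreeTwistedG`, `def charThreeDictG`, `def dictEquivThreeTwistedG`, `def dictEquivThreeCanonicalG : Ω(splitLineThreeG ⊗ ĉ₃(η₃), χ″₃) ≃ₗ[adelicAlgebra V] (D₃.coinvRep χ).asModule` (D₃ := thetaDistDatumThreeOfG V c S hGR hGR₀ hGR₁ hGR₂ hGR₃ η₀ η₁ η₂ η₃ hι hV hω hη₃c Φarch harm hdef) + _surjective + iSup_range_coinvRep_threeG_eq_dict; cert rc 0 ∕ 153 s, 0 warn ∕ 0 proof-hole; NAMES for audit: HodgeCM.Model.ThetaAdelicSide.coinvRep_coinvEquivThreeG · HodgeCM.Model.ThetaAdelicSide.bigCharThree_isRatTrivial · HodgeCM.Model.ThetaAdelicSide.dictEquivThreeCanonicalG_surjective) (`HOME/mc/pub-hodgecm-mc-sinst-1-g11/stage70/HodgeCM/Model/AdelicThetaSlotThreeBridgeG.lean`, md5 503fb57f1c6e, 372 lines);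
landed by the gen-30 packager (p-g30) in gate run 71 as `HodgeCM/Model/AdelicThetaSlotThreeBridgeG.lean` (verbatim).
-/
/-
Copyright (c) 2026 the pub-hodgecm formalisation cell (harness21).  New file, not vendored.
Origin: session prover-pub-hodgecm-mc-sinst-1-g11-0 (unit pub-hodgecm-mc-sinst-1-g11, S-INSTANCE CONSTRUCTOR gen 11; the (J4)↔(J3) BRIDGE of
SLOT 3 (the conjugated plane's second line) cut ONCE over the pin-agnostic G-datum (lead 1-g84 ROUTING WORD 2026-08-21T02:34:03Z): the slot-1
text of `Model/AdelicThetaSlotOneBridgeG` with `dW' c.D 1`, `hGR₃`, `cmConjLineChar₁` and the slot character `η₃` GENERIC (twisted in general: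
`c_{V,3} = η₃(·,1)` is `1` at the default split but `ν'` at the R2 pin), side `S` arbitrary), 2026-08-21.
Intended final place: `HodgeCM/Model/AdelicThetaSlotThreeBridgeG.lean` (NEW additive model-layer leaf; imports sinst-1 #1262 `Model/AdelicThetaDistributionOfG`,
#1256 `Model/AdelicThetaDistributionBridgeTwist` (hence #1254, #1255, axioms-1 #8); nothing imports it yet (the slot-3 automorphy sibling will);
drop alone).
-/
import Summits.HodgeConjecture.HodgeCM.Model.AdelicThetaDistributionOfG
import Summits.HodgeConjecture.HodgeCM.Model.AdelicThetaDistributionBridgeTwist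

set_option autoImplicit false

/-!
# Slot 3 over the G-datum: the honest module `Ω₃(χ)` is a dictionary carrier at a TWISTED record, for ANY slot character `η₃`

For any side `S` reading back to `lineRepOf … η₀ η₁ η₂ η₃` (`hω`, `hι`) and the G-datum `D₃ := thetaDistDatumThreeOfG … η₃ …` (#1262):
* § 0 NEW index record `splitLineThreeG` (`JW := diagonal (lineVec (dW' c.D 1))`, `s := splittingOf hGR₃`) and coinvariant character `chiThreeG χ`;
* § 1 `cVThreeG ∕ cWThreeG ∕ psiThreeG` (the slot characters at a GENERIC `η₃`), `coinvEquivThreeG`,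
  `coinvRep_coinvEquivThreeG` (intertwining law), **`ΩEquivThreeG : (twist (cVThreeG η₃) (Ω(splitLineThreeG, ψ) ∘ finFrameCongr)).asModule ≃ₗ[adelicAlgebra V]
  Ω₃(χ)`**, blocks equal — #1254 § 3b's text for the conjugated line;
* § 2 the twisted record (#1256's slot-0 pattern): `adelicCharThree η₃ := η₃(·,1) · χ₃(·,1)` on `U(diag frameD V)(𝔸)`,
  `bigCharThree := LinePair.bigCharOfV … (adelicCharThree η₃)`, `twistCharV_bigCharThree_comp` (its `V`-part along `finFrameCongr` IS `cVThreeG η₃`),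
  `bigCharThree_isRatTrivial` under the ONE hypothesis **`hη₃V : ∀ v ∈ CMRat (frameD V), η₃ (v, 1) = 1`** (default split: `eta₃ η (v,1) = 1`
  identically; R2 pin: `etaT₃ η ν' (v,1) = ν' v`, rational by `hν'`), `splitLineThreeTwistedG`, `dictEquivThreeOfBigChar`, **`dictEquivThreeTwistedG`**,
  `charThreeDictG χ := twistCharW bigCharThree · psiThreeG χ`, **`dictEquivThreeCanonicalG`** + `_surjective` — the `adelicAlgebra V`-linear surjection
  binder-2's #101 ∕ #102 socket consumes, slot 3, at every pin.
KERNEL only: 0 records, 0 `def … : Prop`, nothing cited as a hypothesis; `#print axioms` ⊆ {propext, Classical.choice, Quot.sound}.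
-/

noncomputable section

open MulAction IsDedekindDomain NumberField.mixedEmbedding
open NumberField hiding relNormOneIdeles relNormOneRat probHaarRelNormOneQuot relNormOneInfUnits relNormOneInfToIdeles
open scoped Matrix TensorProduct Classical SchwartzMap
open Literature.NumberTheory.Automorphic Literature.NumberTheory.Weil1964
open Literature.NumberTheory.GelbartRogawski1991 Literature.NumberTheory.GelbartRogawski1991.UnitaryDualPair
open Literature.RepresentationTheory (SeesawScalar.twist SeesawScalar.twist_apply)
open Literature.Geometry.ComplexHyperbolic.BallModel (U21 x₀)
open Literature.AlgebraicGeometry.ShimuraVarieties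
open HodgeCM.Adelic HodgeCM.PerL34 HodgeCM.Model.ArchSideTerm HodgeCM.Model.ThetaDistFin

namespace HodgeCM.Model
namespace ThetaAdelicSide

variable {L : CMField} {ι₁ : L →+* ℂ} (V : HermSpace3 L ι₁) (c : SeesawCtx L) (S : ThetaAdelicSide V c)
  (hGR : (cmSplittingDatum (L : Type) finProdFinEquiv (frameD V) (frameD_real V) (frameD_ne V) (dW c.D) (dW_real c.D)
    (dW_ne c.D)).CompatibleSplitting)
  (hGR₀ : (cmSplittingDatum (L : Type) (e₁) (frameD V) (frameD_real V) (frameD_ne V) (lineVec (L : Type) (dW c.D 0))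
    (fun _ => dW_real c.D 0) (fun _ => dW_ne c.D 0)).CompatibleSplitting)
  (hGR₁ : (cmSplittingDatum (L : Type) (e₁) (frameD V) (frameD_real V) (frameD_ne V) (lineVec (L : Type) (dW c.D 1))
    (fun _ => dW_real c.D 1) (fun _ => dW_ne c.D 1)).CompatibleSplitting)
  (hGR₂ : (cmSplittingDatum (L : Type) (e₁) (frameD V) (frameD_real V) (frameD_ne V) (lineVec (L : Type) (dW' c.D 0))
    (fun _ => dW'_real c.D 0) (fun _ => dW'_ne c.D 0)).CompatibleSplitting)
  (hGR₃ : (cmSplittingDatum (L : Type) (e₁) (frameD V) (frameD_real V) (frameD_ne V) (lineVec (L : Type) (dW' c.D 1))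
    (fun _ => dW'_real c.D 1) (fun _ => dW'_ne c.D 1)).CompatibleSplitting)
  (η₀ η₁ η₂ η₃ : CMAdelic (L : Type) (frameD V) × CMAdelicOne (L : Type) →* ℂˣ)
  (hι : S.ιinf = archInfOf V)
  (hV : IsAnisotropic L V.Hm)
  (hω : (S.P 3).ω = lineRepOf V c.D hGR hGR₀ hGR₁ hGR₂ hGR₃ η₀ η₁ η₂ η₃ 3)
  (hη₃c : Continuous fun p => ((η₃ p : ℂˣ) : ℂ))

/-! ## § 0. The index record and the coinvariant character of slot 3 (the conjugated plane's line `⟨a₃⟩`, `a₃ = dW' c.D 1`) -/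

/-- **the dictionary index record of slot 3**: the framed hermitian line `⟨a₃⟩` (`a₃ = dW' c.D 1`, the conjugated plane) over `L`,
enumeration `e₁`, with the CHOSEN compatible pair splitting `splittingOf hGR₃` of `U(diag frameD V) × U(⟨a₃⟩)` ([GelbartRogawski1991,
Prop. 3.1.1] as cited by `hGR₃`) — a `SplitLine` at the framed `V`-datum `JV := diagonal (frameD V)` (#1254 `splitLineZero` with `dW' c.D 1`). -/
def splitLineThreeG :
    SplitLine (Matrix.diagonal (frameD V)) (realDiagonal (L : Type) (frameD V) (frameD_real V))
      (complexConj_imagUnit (L : Type)) (imagUnit_ne_zero (L : Type)) (imagUnit_mul_self (L : Type))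
      (realDiagonal_isSymm (L : Type) (frameD V) (frameD_real V))
      (isUnit_det_realDiagonal (L : Type) (frameD V) (frameD_real V) (frameD_ne V))
      (realDiagonal_map (L : Type) (frameD V) (frameD_real V)).symm where
  n := 3
  e := e₁
  JW := Matrix.diagonal (lineVec (L : Type) (dW' c.D 1))
  TW := realDiagonal (L : Type) (lineVec (L : Type) (dW' c.D 1)) fun _ => dW'_real c.D 1
  hW := realDiagonal_isSymm (L : Type) (lineVec (L : Type) (dW' c.D 1)) fun _ => dW'_real c.D 1
  hWd := isUnit_det_realDiagonal (L : Type) (lineVec (L : Type) (dW' c.D 1)) (fun _ => dW'_real c.D 1) fun _ => dW'_ne c.D 1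
  hJW := (realDiagonal_map (L : Type) (lineVec (L : Type) (dW' c.D 1)) fun _ => dW'_real c.D 1).symm
  s := splittingOf _ _ _ _ _ _ _ _ _ _ _ _ _ _ _ _ _ hGR₃
  hs := splittingOf_isCompatible _ _ _ _ _ _ _ _ _ _ _ _ _ _ _ _ _ hGR₃

/-- **`χ ↦ chiThreeG χ : u ↦ χ(finLineTorusIdeles u)⁻¹`** — the coinvariant character of slot 3 (the `chiFin` of every slot-3 G-datum,
definitionally: `toIdele := finLineTorusIdeles (dW' c.D 1)`). -/
def chiThreeG (χ : PontryaginDual (↥(relNormOneIdeles (↥(maximalRealSubfield L)) L) ⧸ relNormOneRat (↥(maximalRealSubfield L)) L)) :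
    UfThree c.D →* ℂˣ :=
  (Circle.toUnits : Circle →* ℂˣ).comp <| (invMonoidHom : Circle →* Circle).comp <|
    (χ : ↥(relNormOneIdeles (↥(maximalRealSubfield L)) L) ⧸ relNormOneRat (↥(maximalRealSubfield L)) L →* Circle).comp <|
      (QuotientGroup.mk' (relNormOneRat (↥(maximalRealSubfield L)) L)).comp
        (finLineTorusIdeles (L : Type) (dW' c.D 1) (dW'_ne c.D 1))

/-! ## § 1. The slot-3 characters at a generic `η₃` and the coinvariant comparison -/

/-- **`c_{V,3}(η₃) : k ↦ finCharThree η₃ (k, 1)`** — the `U(V)(𝔸_f)`-part of the slot-3 see-saw character for the slot character `η₃`. -/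
def cVThreeG : ↥V.adelicFin →* ℂˣ :=
  (finCharThree V c.D hGR hGR₂ hGR₃ η₃).comp (MonoidHom.inl _ _)

/-- **`c_{W,3}(η₃) : u ↦ finCharThree η₃ (1, u)`**. -/
def cWThreeG : UfThree c.D →* ℂˣ :=
  (finCharThree V c.D hGR hGR₂ hGR₃ η₃).comp (MonoidHom.inr _ _)

/-- (Ported verbatim from the HodgeCMPerL package; no docstring in the source.) -/
@[simp] theorem cVThreeG_apply (g : ↥V.adelicFin) :
    cVThreeG V c hGR hGR₂ hGR₃ η₃ g = finCharThree V c.D hGR hGR₂ hGR₃ η₃ (g, 1) := rfl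

/-- (Ported verbatim from the HodgeCMPerL package; no docstring in the source.) -/
@[simp] theorem cWThreeG_apply (u : UfThree c.D) :
    cWThreeG V c hGR hGR₂ hGR₃ η₃ u = finCharThree V c.D hGR hGR₂ hGR₃ η₃ (1, u) := rfl

/-- **the untwisted dictionary-side character `ψ₃(η₃, χ) := chiThreeG χ · c_{W,3}(η₃)⁻¹`**. -/
def psiThreeG (χ : PontryaginDual (↥(relNormOneIdeles (↥(maximalRealSubfield L)) L) ⧸ relNormOneRat (↥(maximalRealSubfield L)) L)) :
    UfThree c.D →* ℂˣ :=
  chiThreeG c χ * (cWThreeG V c hGR hGR₂ hGR₃ η₃)⁻¹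

/-- (Ported verbatim from the HodgeCMPerL package; no docstring in the source.) -/
theorem chiThreeG_eq_mul_psiThreeG
    (χ : PontryaginDual (↥(relNormOneIdeles (↥(maximalRealSubfield L)) L) ⧸ relNormOneRat (↥(maximalRealSubfield L)) L))
    (u : UfThree c.D) :
    chiThreeG c χ u = finCharThree V c.D hGR hGR₂ hGR₃ η₃ (1, u) * psiThreeG V c hGR hGR₂ hGR₃ η₃ χ u := by
  rw [psiThreeG, MonoidHom.mul_apply, MonoidHom.inv_apply, cWThreeG_apply, mul_comm (chiThreeG c χ u), ← mul_assoc, mul_inv_cancel,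
    one_mul]

section Coinv

variable (Φarch : Module.Dual ℂ (Fin 2 → ℂ) →ₗ[ℂ] 𝓢((Fin 3 → mixedSpace (↥(maximalRealSubfield L))), ℂ))
  (harm : ∀ (u : ↥(stabilizer U21 x₀)) (ℓ : Module.Dual ℂ (Fin 2 → ℂ)),
    lineOmega_three V c.D hGR hGR₂ hGR₃ η₃ (u : U21) (Φarch ℓ) =
      Φarch ((BallForms.isPullbackCocycle_cotangentCocycle.weightOf x₀).dual u ℓ))
  (hdef : ∀ a : UnitaryGroup.arch (↥(maximalRealSubfield L)) L (IsCMField.complexConj L) 3 V.Hm,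
    UnitaryGroup.archAt (↥(maximalRealSubfield L)) L (IsCMField.complexConj L) 3 V.Hm (UnitaryGroup.cmPlace (L : Type) ι₁)
        (NumberField.complexConj_smul_infinitePlace (L : Type) _) (IsCMField.complexConj_ne_one (L : Type)) a = 1 →
    ∀ (ℓ : Module.Dual ℂ (Fin 2 → ℂ)) (Φf : FinSB (↥(maximalRealSubfield L)) (Fin 3)),
      lineRepOf V c.D hGR hGR₀ hGR₁ hGR₂ hGR₃ η₀ η₁ η₂ η₃ 3
          (HodgeCM.Adelic.regimeEquiv L V.Hm hV
            (UnitaryGroup.archToAdelic (↥(maximalRealSubfield L)) L (IsCMField.complexConj L) 3 V.Hm a), 1)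
          (piSchwartzBruhatEquiv (↥(maximalRealSubfield L)) (Fin 3) (Φarch ℓ ⊗ₜ[ℂ] Φf)) =
        piSchwartzBruhatEquiv (↥(maximalRealSubfield L)) (Fin 3) (Φarch ℓ ⊗ₜ[ℂ] Φf))
  (χ : PontryaginDual (↥(relNormOneIdeles (↥(maximalRealSubfield L)) L) ⧸ relNormOneRat (↥(maximalRealSubfield L)) L))
  (ψ : UfThree c.D →* ℂˣ)
  (hψ : ∀ u : UfThree c.D, chiThreeG c χ u = finCharThree V c.D hGR hGR₂ hGR₃ η₃ (1, u) * ψ u)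

local notation "D₃" => thetaDistDatumThreeOfG V c S hGR hGR₀ hGR₁ hGR₂ hGR₃ η₀ η₁ η₂ η₃ hι hV hω hη₃c Φarch harm hdef

/-- (T-W) `ω_{f,W}(u) (R f) = finCharThree η₃ (1, u) • R (finPairRepW splitLineThreeG.hs u f)` for the G-datum. -/
theorem ωfW_threeG_finSBReindex (u : UfThree c.D) (f : FinSB (↥(maximalRealSubfield L)) (Fin 3 × Fin 1)) :
    (D₃).ωfW u (finSBReindex (↥(maximalRealSubfield L)) e₁ f) =
      ((finCharThree V c.D hGR hGR₂ hGR₃ η₃ (1, u) : ℂˣ) : ℂ) •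
        finSBReindex (↥(maximalRealSubfield L)) e₁
          (HodgeCM.WeilCoinv.finPairRepW _ _ _ _ _ _ _ _ _ _ _ _ _ _ _ _ _ (splitLineThreeG V c hGR₃).hs u f) := by
  show finRepThree V c.D hGR hGR₂ hGR₃ η₃ (1, u) _ = _
  rw [finRepThree_apply, map_one, LinearEquiv.symm_apply_apply]
  rfl

/-- (T-V) `ω_{f,V}(g) (R f) = finCharThree η₃ (g, 1) • R (finPairRepV splitLineThreeG.hs (finFrameCongr g) f)` for the G-datum. -/
theorem ωfV_threeG_finSBReindex (g : ↥V.adelicFin) (f : FinSB (↥(maximalRealSubfield L)) (Fin 3 × Fin 1)) :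
    (D₃).ωfV g (finSBReindex (↥(maximalRealSubfield L)) e₁ f) =
      ((finCharThree V c.D hGR hGR₂ hGR₃ η₃ (g, 1) : ℂˣ) : ℂ) •
        finSBReindex (↥(maximalRealSubfield L)) e₁
          (HodgeCM.WeilCoinv.finPairRepV _ _ _ _ _ _ _ _ _ _ _ _ _ _ _ _ _ (splitLineThreeG V c hGR₃).hs
            (finFrameCongr (L : Type) V.Hm (frameG V) (frameD V) (frame_congr V) g) f) := by
  show finRepThree V c.D hGR hGR₂ hGR₃ η₃ (g, 1) _ = _
  rw [finRepThree_apply, LinearEquiv.symm_apply_apply]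
  rfl

/-- **THE COINVARIANT COMPARISON OF SLOT 3 (G-datum)**: `Coinv (finPairRepW splitLineThreeG.hs) ψ ≃ₗ[ℂ] Coinv ω_{f,W} (chiFin χ)` whenever
`chiThreeG χ = finCharThree η₃ (1, ·) · ψ`. -/
def coinvEquivThreeG :
    TwistedCoinv.Coinv (HodgeCM.WeilCoinv.finPairRepW _ _ _ _ _ _ _ _ _ _ _ _ _ _ _ _ _ (splitLineThreeG V c hGR₃).hs) ψ ≃ₗ[ℂ]
      TwistedCoinv.Coinv (D₃).ωfW ((D₃).chiFin χ) :=
  TwistedCoinv.mapEquiv _ ψ _ _ (finSBReindex (↥(maximalRealSubfield L)) e₁) (fun u => finCharThree V c.D hGR hGR₂ hGR₃ η₃ (1, u))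
    (fun u f => ωfW_threeG_finSBReindex V c S hGR hGR₀ hGR₁ hGR₂ hGR₃ η₀ η₁ η₂ η₃ hι hV hω hη₃c Φarch harm hdef u f) hψ

/-- (Ported verbatim from the HodgeCMPerL package; no docstring in the source.) -/
@[simp] theorem coinvEquivThreeG_mk (f : FinSB (↥(maximalRealSubfield L)) (Fin 3 × Fin 1)) :
    coinvEquivThreeG V c S hGR hGR₀ hGR₁ hGR₂ hGR₃ η₀ η₁ η₂ η₃ hι hV hω hη₃c Φarch harm hdef χ ψ hψ (TwistedCoinv.mk _ ψ f) =
      TwistedCoinv.mk _ _ (finSBReindex (↥(maximalRealSubfield L)) e₁ f) := rfl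

/-- **THE INTERTWINING LAW (G-datum)**: `Ω₃(χ)(g) (E x) = finCharThree η₃ (g, 1) • E (Ω(splitLineThreeG, ψ)(finFrameCongr g) x)`. -/
theorem coinvRep_coinvEquivThreeG (g : ↥V.adelicFin)
    (x : TwistedCoinv.Coinv (HodgeCM.WeilCoinv.finPairRepW _ _ _ _ _ _ _ _ _ _ _ _ _ _ _ _ _ (splitLineThreeG V c hGR₃).hs) ψ) :
    (D₃).coinvRep χ g (coinvEquivThreeG V c S hGR hGR₀ hGR₁ hGR₂ hGR₃ η₀ η₁ η₂ η₃ hι hV hω hη₃c Φarch harm hdef χ ψ hψ x) =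
      ((finCharThree V c.D hGR hGR₂ hGR₃ η₃ (g, 1) : ℂˣ) : ℂ) •
        coinvEquivThreeG V c S hGR hGR₀ hGR₁ hGR₂ hGR₃ η₀ η₁ η₂ η₃ hι hV hω hη₃c Φarch harm hdef χ ψ hψ
          (HodgeCM.WeilCoinv.weilCoinv _ _ _ _ _ _ _ _ _ _ _ _ _ _ _ _ _ ψ (splitLineThreeG V c hGR₃).hs
            (finFrameCongr (L : Type) V.Hm (frameG V) (frameD V) (frame_congr V) g) x) :=
  TwistedCoinv.mapEquiv_rep _ ψ _ _
    (HodgeCM.WeilCoinv.finPairRepV _ _ _ _ _ _ _ _ _ _ _ _ _ _ _ _ _ (splitLineThreeG V c hGR₃).hs) _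
    (HodgeCM.WeilCoinv.commute_finPairRepV_finPairRepW _ _ _ _ _ _ _ _ _ _ _ _ _ _ _ _ _ (splitLineThreeG V c hGR₃).hs)
    (D₃).commute_ωfV_ωfW _ _ _ hψ
    (fun f => ωfV_threeG_finSBReindex V c S hGR hGR₀ hGR₁ hGR₂ hGR₃ η₀ η₁ η₂ η₃ hι hV hω hη₃c Φarch harm hdef g f) x

/-- the same law against the `c_{V,3}(η₃)`-twisted pullback. -/
theorem coinvEquivThreeG_twist_of_eq (cV : ↥V.adelicFin →* ℂˣ) (hcV : cV = cVThreeG V c hGR hGR₂ hGR₃ η₃) (g : ↥V.adelicFin)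
    (x : TwistedCoinv.Coinv (HodgeCM.WeilCoinv.finPairRepW _ _ _ _ _ _ _ _ _ _ _ _ _ _ _ _ _ (splitLineThreeG V c hGR₃).hs) ψ) :
    coinvEquivThreeG V c S hGR hGR₀ hGR₁ hGR₂ hGR₃ η₀ η₁ η₂ η₃ hι hV hω hη₃c Φarch harm hdef χ ψ hψ
        (SeesawScalar.twist cV
          ((HodgeCM.WeilCoinv.weilCoinv _ _ _ _ _ _ _ _ _ _ _ _ _ _ _ _ _ ψ (splitLineThreeG V c hGR₃).hs).comp
            (finFrameCongr (L : Type) V.Hm (frameG V) (frameD V) (frame_congr V))) g x) =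
      (D₃).coinvRep χ g (coinvEquivThreeG V c S hGR hGR₀ hGR₁ hGR₂ hGR₃ η₀ η₁ η₂ η₃ hι hV hω hη₃c Φarch harm hdef χ ψ hψ x) := by
  subst hcV
  rw [SeesawScalar.twist_apply, coinvRep_coinvEquivThreeG]
  exact map_smul (coinvEquivThreeG V c S hGR hGR₀ hGR₁ hGR₂ hGR₃ η₀ η₁ η₂ η₃ hι hV hω hη₃c Φarch harm hdef χ ψ hψ) _ _

include hψ in
/-- **THE BRIDGE OF SLOT 3 (G-datum), module currency**: `(twist c_{V,3}(η₃) (Ω(splitLineThreeG, ψ) ∘ finFrameCongr)).asModule ≃ₗ[ℂ[U(V)(𝔸_f)]]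
Ω₃(χ)`. -/
def ΩEquivThreeG :
    (SeesawScalar.twist (cVThreeG V c hGR hGR₂ hGR₃ η₃)
          ((HodgeCM.WeilCoinv.weilCoinv _ _ _ _ _ _ _ _ _ _ _ _ _ _ _ _ _ ψ (splitLineThreeG V c hGR₃).hs).comp
            (finFrameCongr (L : Type) V.Hm (frameG V) (frameD V) (frame_congr V)))).asModule ≃ₗ[adelicAlgebra V]
      ((D₃).coinvRep χ).asModule :=
  EquivariantLift.liftEquiv _ _ (coinvEquivThreeG V c S hGR hGR₀ hGR₁ hGR₂ hGR₃ η₀ η₁ η₂ η₃ hι hV hω hη₃c Φarch harm hdef χ ψ hψ)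
    (coinvEquivThreeG_twist_of_eq V c S hGR hGR₀ hGR₁ hGR₂ hGR₃ η₀ η₁ η₂ η₃ hι hV hω hη₃c Φarch harm hdef χ ψ hψ _ rfl)

include hψ in
/-- **BLOCKS EQUAL (slot 3, G-datum)**. -/
theorem iSup_range_coinvRep_threeG_eq {T : Type*} [AddCommMonoid T] [Module ℂ T] [Module (adelicAlgebra V) T]
    [IsScalarTower ℂ (adelicAlgebra V) T] :
    (⨆ f : ((D₃).coinvRep χ).asModule →ₗ[adelicAlgebra V] T, (LinearMap.range f).restrictScalars ℂ) =
      ⨆ f : (SeesawScalar.twist (cVThreeG V c hGR hGR₂ hGR₃ η₃)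
          ((HodgeCM.WeilCoinv.weilCoinv _ _ _ _ _ _ _ _ _ _ _ _ _ _ _ _ _ ψ (splitLineThreeG V c hGR₃).hs).comp
            (finFrameCongr (L : Type) V.Hm (frameG V) (frameD V) (frame_congr V)))).asModule →ₗ[adelicAlgebra V] T,
        (LinearMap.range f).restrictScalars ℂ :=
  (EquivariantLift.iSup_range_eq_of_equiv
    (ΩEquivThreeG V c S hGR hGR₀ hGR₁ hGR₂ hGR₃ η₀ η₁ η₂ η₃ hι hV hω hη₃c Φarch harm hdef χ ψ hψ)).symm

/-! ## § 2. The twisted record of slot 3 (for a generic `η₃` the `V`-part `c_{V,3}(η₃) = η₃(·, 1)` need not be trivial) -/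

variable (ĉ : (splitLineThreeG V c hGR₃).BigChar) (hĉ : (splitLineThreeG V c hGR₃).IsRatTrivial ĉ)
  (hĉV : (HodgeCM.WeilCoinv.twistCharV (↥(maximalRealSubfield L)) (L : Type) (IsCMField.complexConj L) 3 1
      (Matrix.diagonal (frameD V)) (splitLineThreeG V c hGR₃).JW ĉ).comp
        (finFrameCongr (L : Type) V.Hm (frameG V) (frameD V) (frame_congr V)) = cVThreeG V c hGR hGR₂ hGR₃ η₃)
  (χ'' : (splitLineThreeG V c hGR₃).CharW)
  (hχ'' : ∀ u, χ'' u =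
    HodgeCM.WeilCoinv.twistCharW (↥(maximalRealSubfield L)) (L : Type) (IsCMField.complexConj L) 3 1
      (Matrix.diagonal (frameD V)) (splitLineThreeG V c hGR₃).JW ĉ u * ψ u)

include hψ hĉV in
/-- **SLOT 3 LANDS IN THE DICTIONARY THROUGH A TWISTED RECORD**: for a rationally trivial big character `ĉ` of `splitLineThreeG` with `V`-part
`c_{V,3}(η₃)` along `finFrameCongr` and `χ″ = twistCharW ĉ · ψ`, `Ω(splitLineThreeG ⊗ ĉ, χ″) ≃ₗ[ℂ[U(V)(𝔸_f)]] Ω₃(χ)`. -/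
def dictEquivThreeOfBigChar :
    ((splitLineThreeG V c hGR₃).twistBy ĉ hĉ).Ω (finFrameCongr (L : Type) V.Hm (frameG V) (frameD V) (frame_congr V)) χ''
      ≃ₗ[adelicAlgebra V] ((D₃).coinvRep χ).asModule :=
  ((splitLineThreeG V c hGR₃).ΩTwistByEquiv (finFrameCongr (L : Type) V.Hm (frameG V) (frameD V) (frame_congr V)) ĉ hĉ hχ'').trans
    (EquivariantLift.liftEquiv _ _ (coinvEquivThreeG V c S hGR hGR₀ hGR₁ hGR₂ hGR₃ η₀ η₁ η₂ η₃ hι hV hω hη₃c Φarch harm hdef χ ψ hψ)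
      (coinvEquivThreeG_twist_of_eq V c S hGR hGR₀ hGR₁ hGR₂ hGR₃ η₀ η₁ η₂ η₃ hι hV hω hη₃c Φarch harm hdef χ ψ hψ _ hĉV))

end Coinv

/-! ### § 2a. The big character of slot 3 -/

/-- **the adelic `V`-character of slot 3**: `v ↦ η₃(v, 1) · χ₃(v, 1)` on `U(diag frameD V)(𝔸)` (`χ₃(v,1) = λ₄(1) = 1`, kept for symmetry). -/
def adelicCharThree : CMAdelic (L : Type) (frameD V) →* ℂˣ :=
  η₃.comp (MonoidHom.inl _ _) *
    (cmConjLineChar₁ (L : Type) finProdFinEquiv e₁ (frameD V) (frameD_real V) (frameD_ne V) (dW c.D) (dW_real c.D) (dW_ne c.D)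
        (dW' c.D) (dW'_real c.D) (dW'_ne c.D) c.D.isoGL (isoGL_hg₀ c.D) hGR hGR₂ hGR₃).comp (MonoidHom.inl _ _)

/-- (Ported verbatim from the HodgeCMPerL package; no docstring in the source.) -/
@[simp] theorem adelicCharThree_apply (v : CMAdelic (L : Type) (frameD V)) :
    adelicCharThree V c hGR hGR₂ hGR₃ η₃ v =
      η₃ (v, 1) *
        cmConjLineChar₁ (L : Type) finProdFinEquiv e₁ (frameD V) (frameD_real V) (frameD_ne V) (dW c.D) (dW_real c.D) (dW_ne c.D)
        (dW' c.D) (dW'_real c.D) (dW'_ne c.D) c.D.isoGL (isoGL_hg₀ c.D) hGR hGR₂ hGR₃ (v, 1) := rfl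

/-- the line `⟨a₃⟩` has a nonzero Gram entry. -/
theorem lineVec_dW'_one_ne : (Matrix.diagonal (lineVec (L : Type) (dW' c.D 1))) default default ≠ 0 := by
  rw [Fin.default_eq_zero, Matrix.diagonal_apply_eq]
  exact dW'_ne c.D 1

/-- **THE BIG CHARACTER OF SLOT 3**: `ĉ₃(η₃) := adelicCharThree η₃ ∘ (G₁(𝔸) ≃ U(diag frameD V)(𝔸))` (#1255 `LinePair.bigCharOfV`). -/
def bigCharThree : (splitLineThreeG V c hGR₃).BigChar :=
  LinePair.bigCharOfV (↥(maximalRealSubfield L)) (L : Type) (IsCMField.complexConj L) 3 (Matrix.diagonal (frameD V))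
    (Matrix.diagonal (lineVec (L : Type) (dW' c.D 1))) (lineVec_dW'_one_ne c) (adelicCharThree V c hGR hGR₂ hGR₃ η₃)

/-- **its `V`-part along `finFrameCongr` is `c_{V,3}(η₃)`**. -/
theorem twistCharV_bigCharThree_comp :
    (HodgeCM.WeilCoinv.twistCharV (↥(maximalRealSubfield L)) (L : Type) (IsCMField.complexConj L) 3 1
          (Matrix.diagonal (frameD V)) (splitLineThreeG V c hGR₃).JW (bigCharThree V c hGR hGR₂ hGR₃ η₃)).comp
        (finFrameCongr (L : Type) V.Hm (frameG V) (frameD V) (frame_congr V)) =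
      cVThreeG V c hGR hGR₂ hGR₃ η₃ := by
  ext g : 1
  rw [MonoidHom.comp_apply, cVThreeG_apply, finCharThree_apply, finPairDThree_apply, map_one, map_one]
  show (HodgeCM.WeilCoinv.twistCharV (↥(maximalRealSubfield L)) (L : Type) (IsCMField.complexConj L) 3 1
      (Matrix.diagonal (frameD V)) (Matrix.diagonal (lineVec (L : Type) (dW' c.D 1))) (bigCharThree V c hGR hGR₂ hGR₃ η₃)) _ = _
  rw [bigCharThree, LinePair.twistCharV_bigCharOfV, MonoidHom.comp_apply, adelicCharThree_apply]
  rfl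

/-! ### § 2b. Rational triviality of `ĉ₃(η₃)` -/

/-- `χ₃(v, 1) = 1` identically (`cmLineChar₁ = λ₄ ∘ snd`). -/
theorem cmConjLineChar₁_inl_eq_one (v : CMAdelic (L : Type) (frameD V)) :
    cmConjLineChar₁ (L : Type) finProdFinEquiv e₁ (frameD V) (frameD_real V) (frameD_ne V) (dW c.D) (dW_real c.D) (dW_ne c.D)
        (dW' c.D) (dW'_real c.D) (dW'_ne c.D) c.D.isoGL (isoGL_hg₀ c.D) hGR hGR₂ hGR₃ (v, 1) = 1 := by
  rw [cmConjLineChar₁]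
  simp only [MonoidHom.coe_comp, Function.comp_apply, MonoidHom.coe_snd, map_one]

variable (hη₃V : ∀ v ∈ CMRat (L : Type) (frameD V), η₃ (v, 1) = 1)

include hη₃V in
/-- **`adelicCharThree η₃ = 1` on `U(diag frameD V)(L⁺)`** under the ONE hypothesis `hη₃V` (the slot character's `V`-part is automorphic). -/
theorem adelicCharThree_eq_one_of_rat {v : CMAdelic (L : Type) (frameD V)} (hv : v ∈ CMRat (L : Type) (frameD V)) :
    adelicCharThree V c hGR hGR₂ hGR₃ η₃ v = 1 := by
  rw [adelicCharThree_apply, cmConjLineChar₁_inl_eq_one, mul_one, hη₃V v hv]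

include hη₃V in
/-- **`ĉ₃(η₃)` IS RATIONALLY TRIVIAL**. -/
theorem bigCharThree_isRatTrivial : (splitLineThreeG V c hGR₃).IsRatTrivial (bigCharThree V c hGR hGR₂ hGR₃ η₃) := fun γ₀ =>
  LinePair.bigCharOfV_rationalPairToAdelic' _ _ _ _ _ _ _ _ (fun _ hv => adelicCharThree_eq_one_of_rat V c hGR hGR₂ hGR₃ η₃ hη₃V hv) γ₀

/-- **THE TWISTED INDEX RECORD OF SLOT 3**: `splitLineThreeG ⊗ ĉ₃(η₃)`. -/
def splitLineThreeTwistedG :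
    SplitLine (Matrix.diagonal (frameD V)) (realDiagonal (L : Type) (frameD V) (frameD_real V))
      (complexConj_imagUnit (L : Type)) (imagUnit_ne_zero (L : Type)) (imagUnit_mul_self (L : Type))
      (realDiagonal_isSymm (L : Type) (frameD V) (frameD_real V))
      (isUnit_det_realDiagonal (L : Type) (frameD V) (frameD_real V) (frameD_ne V))
      (realDiagonal_map (L : Type) (frameD V) (frameD_real V)).symm :=
  (splitLineThreeG V c hGR₃).twistBy (bigCharThree V c hGR hGR₂ hGR₃ η₃) (bigCharThree_isRatTrivial V c hGR hGR₂ hGR₃ η₃ hη₃V)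

/-- **the canonical dictionary character of slot 3 at `(η₃, χ)`**: `χ″₃ := twistCharW ĉ₃(η₃) · ψ₃(η₃, χ)`. -/
def charThreeDictG (χ : PontryaginDual (↥(relNormOneIdeles (↥(maximalRealSubfield L)) L) ⧸ relNormOneRat (↥(maximalRealSubfield L)) L)) :
    (splitLineThreeG V c hGR₃).CharW :=
  HodgeCM.WeilCoinv.twistCharW (↥(maximalRealSubfield L)) (L : Type) (IsCMField.complexConj L) 3 1
      (Matrix.diagonal (frameD V)) (splitLineThreeG V c hGR₃).JW (bigCharThree V c hGR hGR₂ hGR₃ η₃) *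
    (show (splitLineThreeG V c hGR₃).CharW from psiThreeG V c hGR hGR₂ hGR₃ η₃ χ)

section Canonical

variable (Φarch : Module.Dual ℂ (Fin 2 → ℂ) →ₗ[ℂ] 𝓢((Fin 3 → mixedSpace (↥(maximalRealSubfield L))), ℂ))
  (harm : ∀ (u : ↥(stabilizer U21 x₀)) (ℓ : Module.Dual ℂ (Fin 2 → ℂ)),
    lineOmega_three V c.D hGR hGR₂ hGR₃ η₃ (u : U21) (Φarch ℓ) =
      Φarch ((BallForms.isPullbackCocycle_cotangentCocycle.weightOf x₀).dual u ℓ))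
  (hdef : ∀ a : UnitaryGroup.arch (↥(maximalRealSubfield L)) L (IsCMField.complexConj L) 3 V.Hm,
    UnitaryGroup.archAt (↥(maximalRealSubfield L)) L (IsCMField.complexConj L) 3 V.Hm (UnitaryGroup.cmPlace (L : Type) ι₁)
        (NumberField.complexConj_smul_infinitePlace (L : Type) _) (IsCMField.complexConj_ne_one (L : Type)) a = 1 →
    ∀ (ℓ : Module.Dual ℂ (Fin 2 → ℂ)) (Φf : FinSB (↥(maximalRealSubfield L)) (Fin 3)),
      lineRepOf V c.D hGR hGR₀ hGR₁ hGR₂ hGR₃ η₀ η₁ η₂ η₃ 3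
          (HodgeCM.Adelic.regimeEquiv L V.Hm hV
            (UnitaryGroup.archToAdelic (↥(maximalRealSubfield L)) L (IsCMField.complexConj L) 3 V.Hm a), 1)
          (piSchwartzBruhatEquiv (↥(maximalRealSubfield L)) (Fin 3) (Φarch ℓ ⊗ₜ[ℂ] Φf)) =
        piSchwartzBruhatEquiv (↥(maximalRealSubfield L)) (Fin 3) (Φarch ℓ ⊗ₜ[ℂ] Φf))
  (χ : PontryaginDual (↥(relNormOneIdeles (↥(maximalRealSubfield L)) L) ⧸ relNormOneRat (↥(maximalRealSubfield L)) L))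

local notation "D₃" => thetaDistDatumThreeOfG V c S hGR hGR₀ hGR₁ hGR₂ hGR₃ η₀ η₁ η₂ η₃ hι hV hω hη₃c Φarch harm hdef

/-- **SLOT 3, CANONICAL FORM (G-datum)**: `Ω(splitLineThreeG ⊗ ĉ₃(η₃), χ″₃) ≃ₗ[ℂ[U(V)(𝔸_f)]] Ω₃(χ)` — the index pair
`(splitLineThreeTwistedG, charThreeDictG χ)` of axioms-1's dictionary at `ιVE V = finFrameCongr` carries EXACTLY the honest slot-3 module of the
G-datum, at every pin. -/
def dictEquivThreeCanonicalG :
    (splitLineThreeTwistedG V c hGR hGR₂ hGR₃ η₃ hη₃V).Ω (finFrameCongr (L : Type) V.Hm (frameG V) (frameD V) (frame_congr V))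
        (charThreeDictG V c hGR hGR₂ hGR₃ η₃ χ) ≃ₗ[adelicAlgebra V] ((D₃).coinvRep χ).asModule :=
  dictEquivThreeOfBigChar V c S hGR hGR₀ hGR₁ hGR₂ hGR₃ η₀ η₁ η₂ η₃ hι hV hω hη₃c Φarch harm hdef χ
    (psiThreeG V c hGR hGR₂ hGR₃ η₃ χ) (chiThreeG_eq_mul_psiThreeG V c hGR hGR₂ hGR₃ η₃ χ) _ _
    (twistCharV_bigCharThree_comp V c hGR hGR₂ hGR₃ η₃) (charThreeDictG V c hGR hGR₂ hGR₃ η₃ χ) fun _ => rfl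

/-- hence the `adelicAlgebra V`-linear SURJECTION binder-2's block socket (#101 ∕ #102) consumes, slot 3, any pin. -/
theorem dictEquivThreeCanonicalG_surjective :
    Function.Surjective (dictEquivThreeCanonicalG V c S hGR hGR₀ hGR₁ hGR₂ hGR₃ η₀ η₁ η₂ η₃ hι hV hω hη₃c hη₃V Φarch harm hdef χ) :=
  (dictEquivThreeCanonicalG V c S hGR hGR₀ hGR₁ hGR₂ hGR₃ η₀ η₁ η₂ η₃ hι hV hω hη₃c hη₃V Φarch harm hdef χ).surjective

/-- **BLOCKS EQUAL (slot 3, dictionary currency, G-datum)**. -/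
theorem iSup_range_coinvRep_threeG_eq_dict {T : Type*} [AddCommMonoid T] [Module ℂ T] [Module (adelicAlgebra V) T]
    [IsScalarTower ℂ (adelicAlgebra V) T] :
    (⨆ f : ((D₃).coinvRep χ).asModule →ₗ[adelicAlgebra V] T, (LinearMap.range f).restrictScalars ℂ) =
      ⨆ f : (splitLineThreeTwistedG V c hGR hGR₂ hGR₃ η₃ hη₃V).Ω (finFrameCongr (L : Type) V.Hm (frameG V) (frameD V) (frame_congr V))
          (charThreeDictG V c hGR hGR₂ hGR₃ η₃ χ) →ₗ[adelicAlgebra V] T, (LinearMap.range f).restrictScalars ℂ :=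
  (EquivariantLift.iSup_range_eq_of_equiv
    (dictEquivThreeCanonicalG V c S hGR hGR₀ hGR₁ hGR₂ hGR₃ η₀ η₁ η₂ η₃ hι hV hω hη₃c hη₃V Φarch harm hdef χ)).symm

end Canonical

end ThetaAdelicSide
end HodgeCM.Model

end
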